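import Summits.BirchSwinnertonDyer.Rank1Residual.Supersingular.DescentLowerBound
import Summits.BirchSwinnertonDyer.Rank1Residual.Supersingular.RankOneRem13RecordShapesCount
import HarnessLib

/-!
# Route `SignedLowerHalves`, crux `SprungLowerHalfAtThree` (item stmt-BirchSwinnertonDyer-19003), its LEAF
# BRANCH `r_an = 0 ∧ surj(3)` PER PAIR: the record SHAPE «literal model + `Sel^(3)(E/ℚ) ≠ 0` ⇒ `BSD(E,3)`»
# at `ord₃ #Ш_an ≤ 2` from PUBLISHED facts (cell `bsd-ssimc`, seat `bsd-ssimc-k3-c5` gen 5; a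
# `--supports … --as helper` file; closes nothing about the crux)

PARTITION (cell bsd-ssimc): X8 (A8) × the `r_an = 0 ∧ surj(3)` cells with `ord₃ #Ш_an = 2` — closes PER
PAIR only (through the records that instantiate this shape; OFFERS, the desk books); types nothing new;
crux 5 (`Summit.BirchSwinnertonDyer.BirchSwinnertonDyer.Theses.SignedLowerHalves.SprungLowerHalfAtThree`)
stays OPEN (its clause (A) is the Modularity Theorem on X8, `…Characterization.lean`). HONEST FRAMING: BSD
is not proved by any of this; nothing here is new mathematics; THEOREMS ONLY (no definition, no named
fact, no `sorry`).

## What this file does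

The tree already holds, from cell `b2b-bsdres`:
* the PUBLISHED-facts per-pair consumer
  `Supersingular.X8.bsdp_rankZero_of_casselsTate_of_selmerGroup_ne_bot_of_surj` (`DescentLowerBound.lean`):
  on an X8 pair (`p = 3` good supersingular, `a_3 = ±3`) with `r_an = 0`, `ρ̄_{E,3}` onto, `#Ш_an = q`,
  `ord₃ q ≤ 2` and `Sel^(3)(E/ℚ) ≠ 0`: `BSD(E,3)` — chain: GZK (`hGZK`) gives rank `0` and `Ш` finite;
  `E[3]` irreducible (`ClassX8.irr`) kills `3`-torsion, so `Sel^(3) ↪ Ш[3]` is non-zero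
  (`Typed.exists_sha_torsion_of_selmerGroup_ne_bot`, PROVED) ⇒ `3 ∣ #Ш` ⇒ `9 ∣ #Ш` by Cassels–Tate
  squareness (`hCT`) ⇒ `MissingLowerBoundAt W 3`; the upper half is Wuthrich 2014 Prop. 21 (`hW`, image
  onto) + modularity (`hmod`);
* the two-engine exact `3`-descent rows `dim_𝔽₃ Sel^(3)(E/ℚ) = 2` for ALL 49 window cells of this shape
  (`Supersingular/X8DescentRecords.lean`, `checked_x8_rankZero_sha9_desc3_1…5`, kit j091546);
* kernel certificates `surj_x8r0_<label>_3` (`RankZeroSurjThreeCertificates_01–03`) for every one of them.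

This file supplies the one missing glue: the consumer READ OFF A LITERAL MODEL `⟨a₁,a₂,a₃,a₄,a₆⟩` —
global minimality as a hypothesis (bounded Kraus certificate at the call site), `3 ∤ Δ` and the schema
point count `countPoints [a₁,…,a₆] 3 ∈ {1, 7}` (so `a_3 = ±3`, `ClassX8 W 3` by `classX8_of_intModel`), the
surjectivity certificate, and the displayed per-pair lines `r_an = 0`, `#Ш_an = q` with `ord₃ q ≤ 2`,
`Sel^(3)(E/ℚ) ≠ ⊥` — exactly the hypothesis handling of
`Supersingular.X8RankZero.bsdp_three_of_kim2025_OPEN_of_ainvs_of_certifiedOddL_of_LValueBall` (the K25 offer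
shape) and `SecondDescent.X8.bsdp_three_rankZero_of_ainvs_of_two_nonempty_of_surj` (the B-1 shape), with NO
OPEN binder. The 49 records `X8.bsdp3_sel9_<label>` live in `…SelmerNineRecords{A,B,C}.lean`.

References: [Wuthrich2014] Prop. 21; [SilvermanAEC2009] Thm. X.4.14, X.4.2(a), VII.5 Prop. 5.1(a);
[Serre1972] §1.11 Prop. 12; [Miller2011LMS] Def. 1.1; [IrelandRosen1990] Prop. 5.1.2, §8.1.
-/

set_option autoImplicit false
set_option linter.dupNamespace false

noncomputable section

open scoped Classical

open WeierstrassCurve Literature.NumberTheory.EllipticCurves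
  Literature.NumberTheory.EllipticCurves.Rank1Residual
  Literature.NumberTheory.EllipticCurves.Rank1Residual.Typed
  Literature.NumberTheory.EllipticCurves.Rank1Residual.X11RankOneCertificates
  Literature.NumberTheory.EllipticCurves.Wuthrich2014
  Summit.BirchSwinnertonDyer.BirchSwinnertonDyer.Rank1Residual.IntModel
  Summit.BirchSwinnertonDyer.BirchSwinnertonDyer.Rank1Residual.X11RankOne
  Summit.BirchSwinnertonDyer.Rank1Residual.X11b
  Summit.BirchSwinnertonDyer.Rank1Residual.Supersingular

namespace Summit.BirchSwinnertonDyer.BirchSwinnertonDyer.Theorems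

/-- **RECORD SHAPE — X8 ∩ {r_an = 0} ∩ {surj(3)}, literal model, `ord₃ #Ш_an ≤ 2`: `BSD(E,3)` from
PUBLISHED named facts + the native `3`-descent line `Sel^(3)(E/ℚ) ≠ 0`.** Inputs by name: Cassels–Tate
(`hCT`), Wuthrich 2014 Prop. 21 (`hW`), GZK (`hGZK`), modularity (`hmod`); of the literal model
`⟨a₁,a₂,a₃,a₄,a₆⟩`: global minimality (`hmin`), `3 ∤ Δ` (`h3Δ`), `#Ẽ(𝔽₃) = n₃ ∈ {1, 7}` (`hc₃`, `hn17`: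
class X8 at `3` via `classX8_of_intModel`), `ρ̄_{E,3}` onto (`hsurj`); per pair: `r_an = 0` (`hr`),
`#Ш_an = q` with `ord₃ q ≤ 2` (`hq`, `hv`) and `Sel^(3)(E/ℚ) ≠ ⊥` (`hSel`, the certificate line). Conclusion
= `Supersingular.X8.bsdp_rankZero_of_casselsTate_of_selmerGroup_ne_bot_of_surj` on the literal model.
Per pair; class X8 and crux 5 unchanged; nothing booked. [cite: Wuthrich2014, Prop. 21 (p. 400)]
[cite: SilvermanAEC2009, Thm. X.4.14 and VII.5 Prop. 5.1(a)] [cite: Serre1972, §1.11 Prop. 12]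
[cite: Miller2011LMS, §1 and Def. 1.1] [cite: IrelandRosen1990, Prop. 5.1.2 and §8.1] -/
theorem X8.bsdp_three_rankZero_of_ainvs_of_selmerGroup_ne_bot_of_surj
    (hCT : exists_casselsTate_pairing (K := ℚ)) (hW : sha_dvd_analyticSha)
    (hGZK : rank_eq_analyticRank_of_analyticRank_le_one) (hmod : hasEntireLFunction_rat)
    (a1 a2 a3 a4 a6 : ℤ) (hmin : (⟨a1, a2, a3, a4, a6⟩ : WeierstrassCurve ℚ).IsGloballyMinimal)
    (h3Δ : ¬ (3 : ℤ) ∣ discOf [a1, a2, a3, a4, a6]) {n₃ : ℕ}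
    (hc₃ : countPoints [a1, a2, a3, a4, a6] 3 = n₃) (hn17 : n₃ = 1 ∨ n₃ = 7)
    (hsurj : Surj (⟨a1, a2, a3, a4, a6⟩ : WeierstrassCurve ℚ) 3)
    (hr : (⟨a1, a2, a3, a4, a6⟩ : WeierstrassCurve ℚ).analyticRank = 0)
    {q : ℚ} (hq : shaAn (⟨a1, a2, a3, a4, a6⟩ : WeierstrassCurve ℚ) = (q : ℂ))
    (hv : padicValRat 3 q ≤ 2)
    (hSel : (⟨a1, a2, a3, a4, a6⟩ : WeierstrassCurve ℚ).selmerGroup (3 : ℤ) ≠ ⊥) :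
    BSDp (⟨a1, a2, a3, a4, a6⟩ : WeierstrassCurve ℚ) 3 := by
  have h0 : discOf [a1, a2, a3, a4, a6] ≠ 0 := fun h ↦ h3Δ (by rw [h]; exact dvd_zero _)
  haveI := isElliptic_of_discOf_ne_zero a1 a2 a3 a4 a6 h0
  haveI := hmin
  have hI : integralModelInt (⟨a1, a2, a3, a4, a6⟩ : WeierstrassCurve ℚ) = ⟨a1, a2, a3, a4, a6⟩ :=
    integralModelInt_eq_of_map_eq _ (map_mk_int a1 a2 a3 a4 a6)
  -- class X8 at `3` from `3 ∤ Δ` and the point count `#Ẽ(𝔽₃) ∈ {1, 7}`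
  have hX : ClassX8 (⟨a1, a2, a3, a4, a6⟩ : WeierstrassCurve ℚ) 3 :=
    classX8_of_intModel hI (by rw [intCurve_Δ]; exact h3Δ)
      (natCard_point_eq_of_countPoints a1 a2 a3 a4 a6 3 (by decide) h3Δ hc₃) hn17
  exact X8.bsdp_rankZero_of_casselsTate_of_selmerGroup_ne_bot_of_surj _ 3 hCT hW hGZK hmod hX hsurj hr
    hq hv hSel

end Summit.BirchSwinnertonDyer.BirchSwinnertonDyer.Theorems

end
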